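import Summits.Ventures.QEC.Thresholds.ToricCodeThresholdMemoryFour
import Literature.InformationTheory.QuantumCodes.ToricCodeMixedChannelThreshold
import HarnessLib

/-!
# Certified loss–error trade-off region of the toric code: `ν · (y + 2(1-y)√(p(1-p))) < 1`

Venture QEC, `Summits/Ventures/QEC/Thresholds/` (LADDER-QEC rung Q5; qec-lit-2 gen 3). Packaging of
`ToricCodeMixedChannelThreshold.lean` (Literature: losses of rate `y` with known locations AND independent
`Z`-errors of rate `p`, every family of minimum-weight-outside-the-losses decoders; failure probability
`mixedFamily D y L p → 0` whenever `ν·Υ_CSS(y,p) < 1` under `SAWCountBound C ν`) with the tree's walk-count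
inputs — the same tiers as the pure-loss (`ToricCodeLossThresholds.lean`) and pure-error (`ToricCodeThresholds.lean`)
ladders, which are the two axes `p = 0` (`Υ = y`) and `y = 0` (`Υ = 2√(p(1-p))`) of this region:

| tier | input | certified region (`Υ = y + 2(1-y)√(p(1-p))`) |
|---|---|---|
| CERTIFIED (kernel) | `cₙ ≤ (4/3)3ⁿ` | `3Υ < 1` (`ToricCode.mixedThreshold_three`, Literature) |
| CERTIFIED (kernel) | memory-4 count | `26^{1/3}·Υ < 1` (`lossError_belowThreshold_memoryFour`) |
| CERTIFIED (kernel, symbolic) | Fekete | `μ(ℤ²)·Υ < 1` (`lossError_belowThreshold_connectiveConstant`) |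
| CONDITIONAL | PT2000 fact `μ(ℤ²) ≤ 2.679193` | `2.679193·Υ < 1` (`lossError_belowThreshold_PT2000`) |

HONEST FRAMING: inner (sufficient) regions only; Stace–Barrett–Doherty's numerically determined boundary is the
VALIDATED column and is not claimed. UNCONDITIONAL kernel rows carry no named fact.

## References

* [StaceBarrettDoherty2009] T. M. Stace, S. D. Barrett, A. C. Doherty, PRL 102 (2009) 200501, p. 2–3.
* [DumerKovalevPryadko2015] I. Dumer, A. A. Kovalev, L. P. Pryadko, PRL 115 (2015) 050502, Thm 2.
* [BDGS2012] R. Bauerschmidt, H. Duminil-Copin, J. Goodman, G. Slade, *Lectures on self-avoiding walks*, §1.3.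
-/

noncomputable section

namespace Summit.Ventures.QEC.Thresholds

open Filter Topology
open Literature.InformationTheory.QuantumCodes
open Literature.InformationTheory.QuantumCodes.ToricCode
open Literature.Probability.RandomPlanarGeometry

/-- **Memory-4 tier (kernel)**: every `(y, p)` with `26^{1/3}·(y + 2(1-y)√(p(1-p))) < 1` is inside the
certified correctable region of the toric code under losses and errors (every MWO decoder family).
[cite: DumerKovalevPryadko2015, Thm 2 (Υ_CSS; with the memory-4 SAW count)] -/
theorem lossError_belowThreshold_memoryFour (D : (L : ℕ) → ErasureDecoder (Edge (L + 1)) (Syndrome (L + 1)))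
    (hD : ∀ L, (D L).IsMinWeightOutside (starMatrix (L + 1)))
    {y p : ℝ} (hy0 : 0 ≤ y) (hy1 : y ≤ 1) (hp0 : 0 ≤ p) (hp : p ≤ 1 / 2)
    (h : nuMemFour * upsilonCSS y p < 1) :
    BelowThreshold (mixedFamily D y) p :=
  mixedThreshold_of_sawCountBound (le_trans (by norm_num) nuMemFour_ge) sawCountBound_memoryFour D hD
    hy0 hy1 hp0 hp h

/-- **Symbolic tier (kernel)**: every `(y, p)` with `μ(ℤ²)·Υ_CSS(y,p) < 1` is inside the certified region
(pick `ν` with `μ < ν < 1/Υ` and use Fekete's `cₙ^{1/n} → μ`).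
[cite: BDGS2012, §1.3 eq. (1.12) (c_n^{1/n} → μ)] -/
theorem lossError_belowThreshold_connectiveConstant
    (D : (L : ℕ) → ErasureDecoder (Edge (L + 1)) (Syndrome (L + 1)))
    (hD : ∀ L, (D L).IsMinWeightOutside (starMatrix (L + 1)))
    {y p : ℝ} (hy0 : 0 ≤ y) (hy1 : y ≤ 1) (hp0 : 0 ≤ p) (hp : p ≤ 1 / 2)
    (h : SAW.Zd.connectiveConstant 2 * upsilonCSS y p < 1) :
    BelowThreshold (mixedFamily D y) p := by
  set μ := SAW.Zd.connectiveConstant 2 with hμ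
  have hμ1 : 1 ≤ μ := SAW.Zd.one_le_connectiveConstant 2
  have hΥ0 : 0 ≤ upsilonCSS y p := by
    unfold upsilonCSS
    have := Real.sqrt_nonneg (p * (1 - p))
    nlinarith
  rcases hΥ0.eq_or_lt with hΥ | hΥpos
  · -- `Υ = 0`: any `ν > μ` works
    obtain ⟨C, hC⟩ := exists_sawCountBound_of_connectiveConstant_lt (show μ < μ + 1 by linarith)
    exact mixedThreshold_of_sawCountBound (by linarith) hC D hD hy0 hy1 hp0 hp (by rw [← hΥ]; simp)
  · -- choose `ν` strictly between `μ` and `1/Υ`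
    have h1 : μ < 1 / upsilonCSS y p := by
      rw [lt_div_iff₀ hΥpos]
      exact h
    set ν : ℝ := (μ + 1 / upsilonCSS y p) / 2 with hνdef
    have hν : μ < ν := by rw [hνdef]; linarith
    have hν' : ν < 1 / upsilonCSS y p := by rw [hνdef]; linarith
    obtain ⟨C, hC⟩ := exists_sawCountBound_of_connectiveConstant_lt hν
    refine mixedThreshold_of_sawCountBound (by linarith) hC D hD hy0 hy1 hp0 hp ?_
    have := (lt_div_iff₀ hΥpos).1 hν'
    linarith

/-- **Pönitz–Tittmann tier (conditional)**: granted `μ(ℤ²) ≤ 2.679193`, every `(y, p)` with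
`2.679193·Υ_CSS(y,p) < 1` is inside the certified region. CONDITIONAL on
`SAW.Zd.BDGS2012_connectiveConstant_two_bounds`. [cite: BDGS2012, §1.3 eq. (1.14)] -/
theorem lossError_belowThreshold_PT2000 (hμ : SAW.Zd.BDGS2012_connectiveConstant_two_bounds)
    (D : (L : ℕ) → ErasureDecoder (Edge (L + 1)) (Syndrome (L + 1)))
    (hD : ∀ L, (D L).IsMinWeightOutside (starMatrix (L + 1)))
    {y p : ℝ} (hy0 : 0 ≤ y) (hy1 : y ≤ 1) (hp0 : 0 ≤ p) (hp : p ≤ 1 / 2)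
    (h : 2.679193 * upsilonCSS y p < 1) :
    BelowThreshold (mixedFamily D y) p := by
  have hΥ0 : 0 ≤ upsilonCSS y p := by
    unfold upsilonCSS
    have := Real.sqrt_nonneg (p * (1 - p))
    nlinarith
  refine lossError_belowThreshold_connectiveConstant D hD hy0 hy1 hp0 hp ?_
  calc SAW.Zd.connectiveConstant 2 * upsilonCSS y p ≤ 2.679193 * upsilonCSS y p :=
        mul_le_mul_of_nonneg_right hμ.2 hΥ0
    _ < 1 := h

/-- The two axes of the region: at `y = 0` the condition is the pure-error one `2ν√(p(1-p)) < 1`, at `p = 0`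
the pure-loss one `ν y < 1`. [cite: DumerKovalevPryadko2015, Thm 2 (Υ_CSS(0,p) = 2√(p(1−p)), Υ_CSS(y,0) = y)] -/
theorem upsilonCSS_axes (y p : ℝ) :
    upsilonCSS 0 p = 2 * Real.sqrt (p * (1 - p)) ∧ upsilonCSS y 0 = y := by
  unfold upsilonCSS
  constructor
  · ring
  · simp

/-- Non-vacuity of the decoder class on every toric code. [cite: DumerKovalevPryadko2015, p. 3 (exhaustive search decoder)] -/
theorem lossError_decoderFamily_exists :
    ∀ L, (ErasureDecoder.minWeightOutside (starMatrix (L + 1))).IsMinWeightOutside (starMatrix (L + 1)) :=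
  fun L => minWeightOutside_isMinWeightOutside_toric (L + 1)

end Summit.Ventures.QEC.Thresholds
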